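import Summits.BirchSwinnertonDyer.BirchSwinnertonDyer.Theorems.PrintCFramBottomClassIndexLawFiveLeThetaQExpansion
import Literature.NumberTheory.ModularForms.CohenEisensteinSeriesModularity
import HarnessLib

/-!
# NF-A ⟹ the Cohen × theta form `H_k · θ(Q²·)^p ∈ ModularForm (Γ₁(4Q²)) (k + (p+1)/2)` with its rational
# `q`-expansion `(Σ H(k,N) qᴺ) · Θ^p`

Width seat `bsd-line-cfram-p1-w8` g7 on crux stmt-BirchSwinnertonDyer-20372
`PrintCFram.BottomClassIndexLawFiveLe`, line `eisenstein-resource-bdp-line`, registry v23/v24, typing lane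
NF-A/NF-B of `stub_cutForm` (crux notes `Lines/eisenstein-resource-bdp-line-w8g6-notes.md` §3.2). Sequel to
`…HalfIntegralBridge` (p689819) and `…ThetaQExpansion` (p690217). INPUT: the statement-only named fact
`Literature.NumberTheory.ModularForms.Cohen1975.thm31_cohenSeries_mem_halfIntModularForms` (Cohen 1975
Thm 3.1 in the tree's half-integral-weight vocabulary: `∃ H ∈ halfIntModularForms (2r+1) 4 1` with
`qCoeffs H N = H(r, N)`, `r ≥ 2`). OUTPUT (CONDITIONAL on that fact only, kernel otherwise): for every
`Q ≥ 1`, `k ≥ 2`, odd `p`, a Mathlib modular form `f ∈ ModularForm (Gamma1 (4Q²)) (k + (p+1)/2)` and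
`Θ ∈ ℕ⟦q⟧` (constant term `1`, support `{Q²m²}`) with
`qExpansion 1 f = ((Σ_N H(k,N) qᴺ) · Θ^p : ℚ⟦q⟧)` mapped to `ℂ⟦q⟧` — the level-`4Q²` integral-weight form
of the crux notes w8g6 §3.2 («NF-A: Cohen Thm 3.1 × θ₀(Q²z)»), whose periodic cut (w3 g12,
`Literature.NumberTheory.ModularForms.ModularFormPeriodicTwist` / `…CutFormPeriodicCut`) and reduction
mod `p` (w6 g6, `Literature.NumberTheory.ModularForms.ModP…`; theta factor `…CutFormThetaFrobenius`) give
the pair `G · T` of (CutForm⁶) — LEAD g13's glue (G4).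

* `qExpansion_eq_mk_qCoeffs`, `map_algebraMap_map_natCast` (bookkeeping);
* **`exists_modularForm_cohen_mul_thetaMul_sq_pow_qExpansion`** (with the function identified as
  `H · θ(Q²·)^p`, `H` = the Cohen form chosen from the fact) and
  **`exists_modularForm_qExpansion_eq_cohen_mul_theta`** (coefficientwise, rational: the input shape of
  `ModP.mem_modPForms_of_coeff_eq`).

No new definitions, no new named facts, no `sorry`; `proof.conditional` on NF-A by design (the fact is
cite-only print: Cohen 1975 Thm 3.1). beyond-print theorem: NO. BSD is not proved by any of this; no
summit statement is proved by this seat; no registered stub is closed by this file.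
-/

set_option autoImplicit false
-- summit-side namespace (single-conjunct summit, D-0017 layout)
set_option linter.dupNamespace false

noncomputable section

open scoped MatrixGroups NumberTheorySymbols ModularForm Manifold

open UpperHalfPlane hiding I
open Complex Filter Topology CongruenceSubgroup

namespace Summit.BirchSwinnertonDyer.BirchSwinnertonDyer.Theorems.PrintCFram.HalfIntegralBridge

open Literature.NumberTheory.EllipticCurves.ModularForms
open Literature.NumberTheory.EllipticCurves.Tunnell1983
open Literature.NumberTheory.ModularForms.CohenEisenstein (cohenH)
open Literature.NumberTheory.ModularForms

variable {N : ℕ}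

/-! ## §8 The Cohen form times the theta factor: NF-A ⟹ `H_k · θ(Q²·)^p ∈ ModularForm (Γ₁(4Q²)) (k+(p+1)/2)`
## with the rational `q`-expansion `(Σ H(k,N) qᴺ) · Θ^p` -/

/-- `qExpansion 1 H` is the power series of the `qCoeffs`. [folklore] -/
theorem qExpansion_eq_mk_qCoeffs (H : ℍ → ℂ) : qExpansion 1 H = PowerSeries.mk (qCoeffs H) := by
  ext n
  rw [PowerSeries.coeff_mk, qCoeffs_apply]

/-- `(ℕ → ℚ → ℂ) = (ℕ → ℂ)` on power series: `(Θ.map ℕ→ℚ).map ℚ→ℂ = Θ.map ℕ→ℂ`. [folklore] -/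
theorem map_algebraMap_map_natCast (Θ : PowerSeries ℕ) :
    PowerSeries.map (algebraMap ℚ ℂ) (PowerSeries.map (Nat.castRingHom ℚ) Θ) =
      PowerSeries.map (Nat.castRingHom ℂ) Θ := by
  rw [← RingHom.comp_apply (PowerSeries.map (algebraMap ℚ ℂ)), ← PowerSeries.map_comp]
  congr 1

/-- **NF-A ⟹ THE COHEN × THETA FORM WITH ITS RATIONAL `q`-EXPANSION.** Assuming Cohen 1975 Thm 3.1 as the
named fact `Cohen1975.thm31_cohenSeries_mem_halfIntModularForms` (`H_k ∈ M_{(2k+1)/2}(4, χ₀)` with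
`q`-coefficients `H(k, N)`): for every `Q ≥ 1`, `k ≥ 2` and odd `p` there are a modular form
`f ∈ ModularForm (Gamma1 (4Q²)) (k + (p+1)/2)` and `Θ ∈ ℕ⟦q⟧` (constant term `1`, support in `{Q² m²}`, the
`q`-expansion of `θ(Q²z)`) such that `qExpansion 1 f` is the image in `ℂ⟦q⟧` of the RATIONAL power series
`(Σ_N H(k,N) qᴺ) · Θ^p ∈ ℚ⟦q⟧` — the level-`4Q²`, weight-`k+(p+1)/2` form of the crux notes w8g6 §3.2 whose
periodic cut reduces mod `p` to `G · T` in (CutForm⁶). CONDITIONAL on the named fact only.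
[cite: Cohen1975, Thm. 3.1] [cite: Shimura1973HalfIntegral, §1] -/
theorem exists_modularForm_cohen_mul_thetaMul_sq_pow_qExpansion
    (hA : Cohen1975.thm31_cohenSeries_mem_halfIntModularForms) {Q : ℕ} (hQ : 0 < Q) {k : ℕ}
    (hk : 2 ≤ k) {p : ℕ} (hp : Odd p) :
    ∃ (f : ModularForm (Gamma1 (4 * Q ^ 2)) ((k + (p + 1) / 2 : ℕ) : ℤ)) (Θ : PowerSeries ℕ),
      qExpansion 1 ⇑f = PowerSeries.map (algebraMap ℚ ℂ)
          (PowerSeries.mk (cohenH k) * PowerSeries.map (Nat.castRingHom ℚ) (Θ ^ p)) ∧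
      PowerSeries.coeff 0 Θ = 1 ∧ (∀ n : ℕ, PowerSeries.coeff n Θ ≠ 0 → ∃ m : ℕ, n = Q ^ 2 * m ^ 2) ∧
      (∀ z : ℍ, f z = (Classical.choose (hA k hk)) z * thetaMul (Q ^ 2) z ^ p) := by
  obtain ⟨hH, hq⟩ := Classical.choose_spec (hA k hk)
  set H := Classical.choose (hA k hk) with hHdef
  haveI : NeZero (4 * Q ^ 2) := ⟨by positivity⟩
  obtain ⟨f, Θ, hf, hfq, h0, hsupp⟩ := exists_modularForm_mul_thetaMul_sq_pow_qExpansion hQ (dvd_refl _)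
    hp (mem_halfIntModularForms_of_dvd (dvd_mul_right 4 (Q ^ 2)) hH)
  refine ⟨f, Θ, ?_, h0, hsupp, fun z ↦ by rw [hf]; rfl⟩
  rw [hfq, map_mul, map_pow, map_algebraMap_map_natCast, map_pow, qExpansion_eq_mk_qCoeffs]
  congr 1
  ext N
  rw [PowerSeries.coeff_mk, PowerSeries.coeff_map, PowerSeries.coeff_mk, hq N]
  rfl

/-- The same without naming the Cohen form: `∃ f Θ` with the rational `q`-expansion (the shape consumed by
the ModP membership rule `ModP.mem_modPForms_of_coeff_eq`: coefficients `a n ∈ ℚ` with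
`coeff n (qExpansion 1 f) = (a n : ℂ)`). [cite: Cohen1975, Thm. 3.1] -/
theorem exists_modularForm_qExpansion_eq_cohen_mul_theta
    (hA : Cohen1975.thm31_cohenSeries_mem_halfIntModularForms) {Q : ℕ} (hQ : 0 < Q) {k : ℕ}
    (hk : 2 ≤ k) {p : ℕ} (hp : Odd p) :
    ∃ (f : ModularForm (Gamma1 (4 * Q ^ 2)) ((k + (p + 1) / 2 : ℕ) : ℤ)) (Θ : PowerSeries ℕ),
      (∀ n : ℕ, (qExpansion 1 ⇑f).coeff n =
        ((PowerSeries.coeff n (PowerSeries.mk (cohenH k) * PowerSeries.map (Nat.castRingHom ℚ) (Θ ^ p))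
          : ℚ) : ℂ)) ∧
      PowerSeries.coeff 0 Θ = 1 ∧ (∀ n : ℕ, PowerSeries.coeff n Θ ≠ 0 → ∃ m : ℕ, n = Q ^ 2 * m ^ 2) := by
  obtain ⟨f, Θ, hfq, h0, hsupp, -⟩ := exists_modularForm_cohen_mul_thetaMul_sq_pow_qExpansion hA hQ hk hp
  refine ⟨f, Θ, fun n ↦ ?_, h0, hsupp⟩
  rw [hfq, PowerSeries.coeff_map]
  rfl

end Summit.BirchSwinnertonDyer.BirchSwinnertonDyer.Theorems.PrintCFram.HalfIntegralBridge

end
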